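import Summits.BirchSwinnertonDyer.BirchSwinnertonDyer.Theses.LeadingTerm
import Summits.BirchSwinnertonDyer.BirchSwinnertonDyer.Theorems.LeadingTermRankLeOne
import Literature.NumberTheory.EllipticCurves.PAdicBSD
import Literature.NumberTheory.EllipticCurves.MordellWeilProofs
import HarnessLib

/-!
# BirchSwinnertonDyer / LeadingTerm — crux `Consistency` (stmt-BirchSwinnertonDyer-16217),
# line `Sketch`, stub S2 `stub_diagonal_two_le`: the quotient of the two BSD conjectures

Registered stub S2 of the skeleton `Cruxes/Consistency/Lines/Sketch.lean` is the crux restricted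
to the DIAGONAL `r_MW = r_an ≥ 2`: one rational `q` with `L^{(r)}(E,1) = r!·q·Ω⁺_f·Reg_∞` and
`[T^r]L_p(f,α,T)·log_p(γ)^r = q·(1-α⁻¹)²·Reg_p(D)` — the rank-`≥ 2` `p`-adic Beilinson formula
(Burns–Kurihara–Sano, arXiv:1910.07404, Conj. 1.1 / Cor. 1.10; no theoretical evidence beyond
`r = 1`, arXiv:2103.11535 p. 2). It is OPEN mathematics; no registered closure lands it from facts.

What this file records, machine-checked, is its TRUTH STATUS inside the tree's own conventions
(the refuter's crux-attack observation, 2026-08-16): S2 is the Ш-free QUOTIENT of the two printed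
conjectures that the tree holds as predicates —

* the archimedean leading-term formula `W.BSDLeadingTermFormula`
  (`L^{(r_an)}(E,1)/r_an! = #Ш·Reg_∞·Ω_E·∏c_v/#tors²`, Tate 1974 Conj. 4(b), Gross PCMS 2011
  Conj. 2.10(2); `BSDInvariants.lean`) together with `W.ShaFinite`, read on the diagonal
  `r_an = r_MW`, and
* clause (ii) of the `p`-adic conjecture `PAdicBSDConjecture W p D`
  (`ϖ·[T^r]L_p·log_p(γ)^r·#tors² = (1-α⁻¹)²·#Ш·Reg_p(D)·∏c_v` for `ϖ·Ω_E = Ω⁺_f`,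
  Mazur–Tate–Teitelbaum 1986 §II.10 Conj. BSD(p), Stein–Wuthrich 2013 §3; `PAdicBSD.lean`)
  at the canonical datum,

with the period ratio `ϖ = Ω⁺_f/Ω_E ∈ ℚ` (Manin constant and lattice index of a modular
parametrisation; tree theorem `ModularParametrizationData.exists_rat_mul_realPeriodRat_eq_plusPeriod`,
taken here as a hypothesis on `(W,f)` to keep modular curves out of the import cone): the SAME
`q = #Ш·∏c_v/(ϖ·#tors²)` solves both identities, all inaccessible factors cancelling — so the
tree's normalisations of `Reg_∞`, `Reg_p`, `log_p(γ)^r`, `(1-α⁻¹)²`, `r!`, `Ω⁺_f` are mutually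
consistent and S2 is not stronger than standard conjectures (`stub_diagonal_two_le_of_bsd_conjectures`).
-/

set_option linter.dupNamespace false

namespace Summit.BirchSwinnertonDyer.BirchSwinnertonDyer.Theorems

open scoped MatrixGroups ModularForm
open CongruenceSubgroup Literature.NumberTheory.EllipticCurves
  Literature.NumberTheory.EllipticCurves.ModularForms WeierstrassCurve

/-- **Stub S2 is the quotient of the archimedean and the `p`-adic BSD conjectures.** Hypotheses
(conjecture PREDICATES of the tree, not facts): `hBSD` — on the diagonal `r_an = r_MW`, `Ш(E)`
is finite and the leading-term formula `W.BSDLeadingTermFormula` holds (Tate 1974 Conj. 4(b));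
`hpBSD` — the `p`-adic BSD conjecture `PAdicBSDConjecture W p D` at a good ordinary `p ≥ 5` for the
canonical datum `D` (Mazur–Tate–Teitelbaum 1986 §II.10); `hϖ` — the period ratio
`ϖ·Ω_E = Ω⁺_f` is rational (Edixhoven 1991 §1 / tree theorem
`exists_rat_mul_realPeriodRat_eq_plusPeriod` for a modular parametrisation). Conclusion: the
registered stub `stub_diagonal_two_le` verbatim, with `q := #Ш·∏c_v/(ϖ·#tors²)`: from
`L^{(r)}(E,1)/r! = #Ш·Reg_∞·Ω_E·∏c_v/#tors²` and `Ω_E = Ω⁺_f/ϖ` the archimedean identity, from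
`ϖ·[T^r]L_p·log^r·#tors² = (1-α⁻¹)²·#Ш·Reg_p·∏c_v` the `p`-adic one (`ϖ ≠ 0` since `Ω⁺_f > 0`;
`#tors ≥ 1`). [cite: MazurTateTeitelbaum1986Invent, §II.10 Conj. BSD(p)] -/
theorem stub_diagonal_two_le_of_bsd_conjectures :
    (∀ (W : WeierstrassCurve ℚ) [W.IsElliptic] [W.IsGloballyMinimal], W.analyticRank =
      W.mordellWeilRank → W.ShaFinite ∧ W.BSDLeadingTermFormula) → (∀ (W : WeierstrassCurve ℚ)
      [W.IsElliptic] [W.IsGloballyMinimal] (p : ℕ) [Fact p.Prime] (D :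
      WeierstrassCurve.PAdicHeightData W p), 5 ≤ p →
      Literature.NumberTheory.EllipticCurves.IsOrdinaryAt W p → D.IsCanonical →
      Literature.NumberTheory.EllipticCurves.PAdicBSDConjecture W p D) → (∀ (W : WeierstrassCurve ℚ)
      [W.IsElliptic] [W.IsGloballyMinimal] {N : ℕ} [NeZero N] (f : CuspForm
      (CongruenceSubgroup.Gamma0 N) 2),
      Literature.NumberTheory.EllipticCurves.ModularForms.IsNewformOf W f → ∃ ϖ : ℚ, (ϖ : ℝ) *
      W.realPeriodRat = Literature.NumberTheory.EllipticCurves.ModularForms.plusPeriod f) → ∀ (W :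
      WeierstrassCurve ℚ) [W.IsElliptic] [W.IsGloballyMinimal] (p : ℕ) [Fact p.Prime], 5 ≤ p →
      Literature.NumberTheory.EllipticCurves.IsOrdinaryAt W p → ∀ (D :
      WeierstrassCurve.PAdicHeightData W p), D.IsCanonical → ∀ ⦃N : ℕ⦄ [NeZero N] (f : CuspForm
      (CongruenceSubgroup.Gamma0 N) 2),
      Literature.NumberTheory.EllipticCurves.ModularForms.IsNewformOf W f → 2 ≤ W.mordellWeilRank →
      W.analyticRank = W.mordellWeilRank → 0 < W.regulator ∧ 0 <
      Literature.NumberTheory.EllipticCurves.ModularForms.plusPeriod f ∧ ∃ q : ℚ, iteratedDeriv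
      W.mordellWeilRank W.entireLFunction 1 = (((W.mordellWeilRank.factorial : ℝ) * (q : ℝ) *
      Literature.NumberTheory.EllipticCurves.ModularForms.plusPeriod f * W.regulator : ℝ) : ℂ) ∧
      PowerSeries.coeff W.mordellWeilRank (Literature.NumberTheory.EllipticCurves.padicLFunction f
      (Literature.NumberTheory.EllipticCurves.unitRoot W p : ℚ_[p])) *
      Literature.NumberTheory.EllipticCurves.padicLog p
      (Literature.NumberTheory.EllipticCurves.cyclotomicGenerator p) ^ W.mordellWeilRank = (q :
      ℚ_[p]) * (1 - (Literature.NumberTheory.EllipticCurves.unitRoot W p : ℚ_[p])⁻¹) ^ 2 *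
      WeierstrassCurve.padicRegulator D := by
  intro hBSD hpBSD hϖ W _ _ p _ h5 hord D hD N _ f hf _ hdiag
  have hreg : 0 < W.regulator := regulator_pos_holds W
  have hΩ : 0 < plusPeriod f := IsNewform0.plusPeriod_pos_holds hf.1 hf.coeffField_eq_bot
  obtain ⟨hSha, hLead⟩ := hBSD W hdiag
  obtain ⟨ϖ, hϖeq⟩ := hϖ W f hf
  have hϖ0 : ϖ ≠ 0 := by
    rintro rfl
    rw [Rat.cast_zero, zero_mul] at hϖeq
    exact hΩ.ne' hϖeq.symm
  have htors : 0 < W.torsionOrder := W.torsionOrder_pos_holds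
  have hfin : Finite W.sha := hSha
  obtain ⟨-, hii⟩ := hpBSD W p D h5 hord hD hord f hf
  have hP := hii hfin ϖ hϖeq
  set r := W.mordellWeilRank with hr
  refine ⟨hreg, hΩ, (W.shaOrder * W.tamagawaProduct : ℚ) / (ϖ * (W.torsionOrder : ℚ) ^ 2), ?_, ?_⟩
  · -- archimedean side: `L^{(r)}(E,1) = r! · leadingLCoeff = r! · bsdRHS`
    have hfac : (r.factorial : ℂ) ≠ 0 := by exact_mod_cast (Nat.factorial_pos r).ne'
    have hL : iteratedDeriv r W.entireLFunction 1 = (r.factorial : ℂ) * W.leadingLCoeff := by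
      unfold WeierstrassCurve.leadingLCoeff
      rw [hdiag, mul_div_cancel₀ _ hfac]
    have hlead' : W.leadingLCoeff = (W.bsdRHS : ℂ) := hLead
    rw [hL, hlead', WeierstrassCurve.bsdRHS_def]
    have hΩE : W.realPeriodRat = plusPeriod f / (ϖ : ℝ) := by
      rw [eq_div_iff (by exact_mod_cast hϖ0 : (ϖ : ℝ) ≠ 0), mul_comm, hϖeq]
    rw [hΩE]
    have hϖR : (ϖ : ℝ) ≠ 0 := by exact_mod_cast hϖ0
    have htR : (W.torsionOrder : ℝ) ≠ 0 := by exact_mod_cast htors.ne'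
    push_cast
    field_simp
  · -- p-adic side: divide clause (ii) of `PAdicBSDConjecture` by `ϖ · #tors²`
    have hϖP : (ϖ : ℚ_[p]) ≠ 0 := by exact_mod_cast hϖ0
    have htP : (W.torsionOrder : ℚ_[p]) ≠ 0 := by exact_mod_cast htors.ne'
    push_cast
    field_simp
    linear_combination hP

end Summit.BirchSwinnertonDyer.BirchSwinnertonDyer.Theorems
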